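import Literature.Geometry.Riemannian.GurskyViaclovskyPath
import Literature.Geometry.Riemannian.GurskyViaclovskyC2Estimate
import HarnessLib

/-!
# Stub `stub_pathHessian` of line `gv-continuity-path` (crux `EntropyRung.ChangGurskyYang`),
# closed MODULO the `C²` estimate along the Weyl-weighted Gursky–Viaclovsky path
# (Gursky–Viaclovsky 2003, Prop. 6, `C²` part; for the `x`-dependent weight: Chen 2005, Thm. 1(a))

STUB 4 of the lead's skeleton of line `gv-continuity-path` (crux stmt-SmoothPoincare4-10834,
`Summit.SmoothPoincare4.SmoothPoincare4.Theses.EntropyRung.ChangGurskyYang`; hypothesis `hHess` of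
its `pathApriori_of`) is the `C²` part of the a-priori estimates of the continuity method of
Gursky–Viaclovsky (J. Differential Geom. 63 (2003), arXiv:math/0301350, §5, Prop. 6: "Let `u_t` be
a `C⁴` solution of (path) for some `δ ≤ t ≤ 1` satisfying `δ̲ < u_t < δ̄`, and
`‖∇u_t‖_{L^∞} < C₁`. Then for `0 < α < 1`, `‖u_t‖_{C^{2,α}} ≤ C₂`, where `C₂` depends only upon
`δ̲, δ̄, C₁`, and `g`. Proof. The `C²` estimate follows from the global estimates in [GVNegative],
or the local estimates [GuanWang1] and [LiLi2]. We remark that the main fact used in deriving these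
estimates is that `σ₂^{1/2}(A^t)` is a concave function of the second derivative variables …
Since `f(x) > 0`, the `C²` estimate implies uniform ellipticity, and the `C^{2,α}` estimate then
follows from the work of [Krylov] and [Evans] on concave, uniformly elliptic equations."), read
for the WEYL-WEIGHTED path of this line (`GurskyViaclovskyPath.lean`, module docstring
"Dictionary": `P_t(h) = σ₂(A_h) − ¼|W_h|² + (1−t)(2−t)R_h²/6 = q e^{8u}` on `h = e^{−2u} g` is, on
the background `g`, Gursky–Viaclovsky's (PDE) `σ₂^{1/2}(g⁻¹A^t_u) = f(x)e^{2u}` with the right-hand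
side replaced by `((1/16)|W_g|²_g + (q/4)e^{4u})^{1/2}` — Gursky–Viaclovsky, §1: "The choice of
the right hand side in (PDE) is quite flexible; the key requirement is simply that the exponent is
a positive multiple of `u`").

For a right-hand side depending on `x` AND `u` the local Hessian estimate is S. Chen, *Local
estimates for some fully nonlinear elliptic equations*, IMRN 2005:63 (arXiv:math/0510652),
Thm. 1(a): for `F(g⁻¹W) = f(x,u) h₀` with `W = ∇²u + a(x) du⊗du + b(x)|∇u|² g + B(x)`,
`b < −δ₁`, `a + n b < −δ₂`, `F` positive, concave, monotone, homogeneous of degree one on its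
cone, and `u ∈ C⁴` on a geodesic ball `B_r`,
"`sup_{B_{r/2}} (|∇²u| + |∇u|²) ≤ C₁(n, r, ‖a‖_{C²}, ‖b‖_{C²}, ‖B‖_{C²}, ‖g‖_{C³}, h₀, δ₁, δ₂, c_sup(r))`",
where `c_sup` is the supremum along the solution of `f` and its `x`- and `z`-derivatives up to
order two; and ibid. Cor. 2, which is literally Gursky–Viaclovsky's equation
"`σ_k^{1/k}(t λ(A_{g_u}) + s σ₁(λ(A_{g_u})) g) = f₀(x) e^{2u}` … `C = C(n, k, r, ‖g‖_{C⁴}, ‖f₀‖_{C²})`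
but is independent of `t, s` and `inf f₀`". Here `n = 4`, `k = 2`, `W = A¹_u = ∇²u + du⊗du −
½|∇u|²g + A¹_g` (`a = 1`, `b = −½`, `B = A¹_g`: Chen, proof of Cor. 1),
`F ∝ σ₂^{1/2}(λ + ((1−t)/2)σ₁(λ)e)` (Gursky–Viaclovsky, §1: `A^t = A¹ + ((1−t)/2) tr(A¹) g`; concave
by [LiLi2003], Chen §1), `h₀ = 1`, `f(x,z) = ((1/16)|W_g|²_g(x) + (q(x)/4)e^{4z})^{1/2}`, smooth with
`c_sup` controlled by `sup|u| ≤ C₀`, `‖q‖_{C²}`, `‖|W_g|²‖_{C²}` and `(min q) e^{−4C₀}` on the compact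
`M`, which is covered by finitely many geodesic half-balls.

None of this interior `C²` theory for concave fully nonlinear equations exists in Mathlib or in
the tree (no Hölder spaces, no Pogorelov/Guan–Wang maximum-principle computations). Following the
NEED-A-PUBLISHED-FACT rule, this file

* USES the printed estimate, specialised to exactly what the stub consumes, as the named fact
  `Literature.Geometry.Riemannian.gurskyViaclovsky_hessianEstimate_weighted_four`
  (`Literature/Geometry/Riemannian/GurskyViaclovskyC2Estimate.lean`; stated inline by this line —
  without scoped notation and with fully qualified tree names, so that it elaborates under any
  preamble — and relocated there by the gate, p99118);
* PROVES the stub conditionally on it: `stub_pathHessian_of_hessianEstimate` (registered on the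
  crux item; colon form `gurskyViaclovsky_hessianEstimate_weighted_four → <stub_pathHessian verbatim>`),
  by definitional unfolding: the fact is the stub statement with `𝓡 4`, `𝓘(ℝ)`, `∞` written out.

So `stub_pathHessian` is exactly `stub_pathHessian_of_hessianEstimate hH` for
`hH : gurskyViaclovsky_hessianEstimate_weighted_four`, and the line is closed at this leaf MODULO
the named fact.

References: M. J. Gursky, J. A. Viaclovsky, *A fully nonlinear equation on four-manifolds with
positive scalar curvature*, J. Differential Geom. 63 (2003) 131–154, §1 ((PDE), the transformation
law of `A^t`), §5, Prop. 6 [GurskyViaclovsky2003]; S. Chen, *Local estimates for some fully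
nonlinear elliptic equations*, Int. Math. Res. Not. 2005, no. 63, 3403–3425, Thm. 1(a), §1
(the functions `σ_k^{1/k}(tλ + sσ₁(λ)e)`), §2.1, Cor. 1–2 [Chen2005]; P. Guan, G. Wang, *Local
estimates for a class of fully nonlinear equations arising from conformal geometry*, Int. Math.
Res. Not. 2003, no. 26, 1413–1432 [GuanWang2003]; A. Li, Y. Y. Li, *On some conformally invariant
fully nonlinear equations*, Comm. Pure Appl. Math. 56 (2003) 1416–1464 [LiLi2003]; S.-Y. A. Chang,
M. J. Gursky, P. C. Yang, Publ. Math. IHÉS 98 (2003) 105–143, (1.10) [ChangGurskyYang2003].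
-/

noncomputable section
open scoped Manifold ContDiff Topology
open Set Filter
open Literature.Geometry.Lorentzian (PseudoRiemannianMetric)
open Literature.Geometry.Lorentzian.PseudoRiemannianMetric
open Literature.Geometry.Riemannian
open Literature.Geometry.Riemannian.GurskyViaclovskyPath

namespace Summit.SmoothPoincare4.SmoothPoincare4.Theorems.GvContinuityPath
set_option linter.dupNamespace false

/-- **STUB 4 of line `gv-continuity-path` (`stub_pathHessian`, verbatim after the hypothesis),
conditional on the named fact `gurskyViaclovsky_hessianEstimate_weighted_four`
(`Literature/Geometry/Riemannian/GurskyViaclovskyC2Estimate.lean`: Gursky–Viaclovsky 2003, Prop. 6,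
`C²` part, along the Weyl-weighted path; Chen 2005, Thm. 1(a) and Cor. 2 for the `x`-dependent
weight).** On a closed `(M⁴, g)`, for a smooth positive right side `q`,
`δ ≤ 1` and levels `C₀`, `C₁` there is `C₂ = C₂(M, g, q, δ, C₀, C₁)` with
`|∇²u|²_g = g.normSq x (g.hessian u x) ≤ C₂` for every smooth admissible solution
`(h = e^{−2u} g, u)` of `P_t(h) = q e^{8u}` at any `t ∈ [δ, 1]` with `|u| ≤ C₀` and `|∇u|²_g ≤ C₁`.
Proof: the named fact is this statement with the scoped notations `𝓡 4`, `𝓘(ℝ)`, `∞` written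
out, so it closes the stub by definitional unfolding.
[cite: GurskyViaclovsky2003, Prop. 6 (§5)] [cite: Chen2005, Thm. 1(a) and Cor. 2] -/
theorem stub_pathHessian_of_hessianEstimate :
    gurskyViaclovsky_hessianEstimate_weighted_four →
    ∀ (M : Type) [TopologicalSpace M] [T2Space M] [SecondCountableTopology M]
      [ChartedSpace (EuclideanSpace ℝ (Fin 4)) M] [IsManifold (𝓡 4) ∞ M] [CompactSpace M]
      (g : PseudoRiemannianMetric (𝓡 4) ∞ (EuclideanSpace ℝ (Fin 4)) (TangentSpace (𝓡 4) : M → Type _))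
      [g.HasLeviCivita], g.IsRiemannian →
      ∀ (q : M → ℝ) (δ C₀ C₁ : ℝ), ContMDiff (𝓡 4) 𝓘(ℝ) ∞ q → (∀ x, 0 < q x) → δ ≤ 1 →
      ∃ C₂ : ℝ, ∀ t : ℝ, δ ≤ t → t ≤ 1 →
        ∀ (h : PseudoRiemannianMetric (𝓡 4) ∞ (EuclideanSpace ℝ (Fin 4)) (TangentSpace (𝓡 4) : M → Type _))
          [h.HasLeviCivita] (u : M → ℝ), IsPathSolution g h u t q →
          (∀ x, |u x| ≤ C₀) → (∀ x, g.gradSq u x ≤ C₁) →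
          ∀ x, g.normSq x (g.hessian u x) ≤ C₂ :=
  fun hH ↦ hH

end Summit.SmoothPoincare4.SmoothPoincare4.Theorems.GvContinuityPath
end
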